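import Summits.QuantumFields.YangMills.Theorems.BalabanUVNodesN08HaarCompatibilityGuardJacobianContractionOperator

/-!
# BalabanUVNodes ∕ N08 — THE ψ-DEFECT OF THE LOG-DIFFERENTIAL IS AN OPERATOR-NORM CONTRACTION BY `ψ(‖Z‖)`, EVERY `N`;
# THE PRINTED exp-mean-log FIBRE MAP MOVES BY `O(1 − Σcᵢ + θ²)·‖X‖` ALONG FIBRES IN OPERATOR NORM, UNIFORMLY IN `N`

WIDTH SEAT `pub-ymgap-dag-n08-w6` g6 (R399 (3a); CLAIM-1 ∕ INTENT-1 of record HOME INBOX l.38866), 2026-08-28.  Track A, DAG node N08 =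
[Balaban1985UV3] Thm 1 p. 257 (compact) + Thm 2 p. 272; [Balaban1987RG1] (0.4) p. 253 (the block average along one gauge fibre); key item K1⁷
`StabilityBAtRecordR13SepCoPH` (stmt-QuantumFields-20542), `--supports … --as helper`.  COUNT-NEUTRAL.  Piece (ii) of the general-`N` port of
n08-w3 g6's monotone height (parts 30A–30C ∕ 31, `N = 2` by quaternions): the N-INDEPENDENT operator-norm control of the fibre velocity.

THE MATHEMATICS ([folklore] matrix analysis over pub-balaban's `T4EMLTangentInjective` BY IMPORT).  For skew-Hermitian `Z` (`‖Z‖ ≤ ρ < π`) with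
eigenframe `Z = U diag(−iθ) U*`, half-angles `β_{ab} = (θₐ − θ_b)∕2`, the solution operator of `dexp(Z) H = exp(Z)·X` is `φ(B_Z) + ½ad_Z`
(g4 `solution_eq_phi_add_adh`; `φ(B_Z)` = the real frame multiplier `1 − ψ(β_{ab})`).  pub-balaban's KEY builds, inside its proof, the resolvent
solutions `vₙ` of `P_{Rₙ,Z} vₙ = A_Z X` (`A_Z = ½ad_Z`, `P_{R,Z} = R + A_Z²`, `Rₙ = (n+1)²π²`) and sums the SCALAR Mittag-Leffler identity.  §1 isolates
the VECTOR identity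
  `φ(B_Z)X − X = Σₙ 2·A_Z vₙ`                                   (`hasSum_adh_frameSol`; entrywise `−ψ(β) = −Σₙ 2β²∕(Rₙ − β²)`, `hasSum_ψ'`),
and the two crude OPERATOR-norm bounds `‖A_Z M‖ ≤ ‖Z‖‖M‖` (`norm_adh_le`), `(R − ‖Z‖²)‖v‖ ≤ ‖Z‖‖X‖` for `P_{R,Z}v = A_Z X` (`norm_sol_le`), whence
  ★★★ `norm_phi_sub_self_le`:  **`‖φ(B_Z)X − X‖ ≤ Σₙ 2ρ²∕(Rₙ − ρ²)·‖X‖ = ψ(ρ)·‖X‖`**   (operator norm; Mittag-Leffler AT `β = ρ`; NO Schur-multiplier theory).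
§2 assembles: for the solutions `Hᵢ` of the `Zᵢ`-systems and `H_Y` of the `Y`-system (`Y = ΣcᵢZᵢ`, `‖Zᵢ‖ ≤ ρᵢ ≤ 1`), the `½ad` halves cancel
(`adh_sum_smul`) and
  ★★ `norm_symmetrised_le`:  `‖H_Y − ΣcᵢHᵢ‖ ≤ (1 − Σcᵢ + ψ(Σcᵢρᵢ) + Σcᵢψρᵢ)·‖X‖`;
  ★★★ `norm_emlD_tangent_le`:  for unitary `W`, unitaries `hᵢ` in the guard `‖hᵢW* − 1‖ < 1∕2`, `cᵢ ≥ 0`, `Σcᵢ ≤ 1`, skew-Hermitian `X`: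
      **`‖D K_W(W X)‖ ≤ e^{Σcᵢρᵢ}·(1 − Σcᵢ + ψ(Σcᵢρᵢ) + Σcᵢψρᵢ)·‖X‖`**   (`D K_W(WX)·W* = dexp(Y)(H_Y − ΣcᵢHᵢ)`, `‖dexp Y‖ ≤ e^{‖Y‖}` = pv11's
      `ExpFDeriv.norm_fderiv_exp_le`), and the W-uniform `…_log_two` (`ρᵢ = log 2`).
So along a gauge fibre the printed map moves, IN OPERATOR NORM and for EVERY `N`, by `≤ e^{θ}(1 − Σcᵢ + 2ψθ)` times the step (30C's drift
constant; there the quaternion norm, where Hilbert–Schmidt = operator).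
HONEST FRAMING.  Count-neutral helper; NO injectivity ∕ (H_K) ∕ density statement in THIS file (pieces (i), (iii)–(v) follow); nothing of Bałaban's
asserted; ONE RG step — the k-uniform `hmass` is NOT supplied (stacking); E6′ NOT decided; N08 NOT discharged; counts unmoved (typed 28∕28 · discharged
5∕27); no summit statement is proved by this seat — one finite 𝕋⁴ programme at fixed ε, R4 closes the CONDITIONAL rung `BalabanLadder.UV` only; the
Yang–Mills mass gap (Clay) is NOT proved by any of this; nothing continuum ∕ ℝ⁴ ∕ OS.  0 `sorry`, 0 `def`, 0 `instance`, 0 `notation`, standard axioms.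
-/

noncomputable section

open NormedSpace Finset
open scoped Matrix Matrix.Norms.L2Operator ComplexConjugate Nat

namespace Summit.QuantumFields.YangMills.BalabanUVNodes.N08HaarCompatibilityGuardDefectOperatorNorm

open Literature.MathematicalPhysics.QuantumFieldTheory.Balaban1983to89
open Literature.MathematicalPhysics.QuantumFieldTheory.Balaban1983to89.T4EMLTangentInjective
open Summit.QuantumFields.YangMills.BalabanUVNodes.N08HaarCompatibilityGuardJacobian
open Summit.QuantumFields.YangMills.BalabanUVNodes.N08HaarCompatibilityGuardJacobianSharpFrame
open Summit.QuantumFields.YangMills.BalabanUVNodes.N08HaarCompatibilityGuardJacobianSharp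
open Summit.QuantumFields.YangMills.BalabanUVNodes.N08HaarCompatibilityGuardJacobianContractionFrame
open Summit.QuantumFields.YangMills.BalabanUVNodes.N08HaarCompatibilityGuardJacobianContractionOperator
open Matrix (single diagonal unitaryGroup)
open Complex (I)
open Literature.MathematicalPhysics.QuantumFieldTheory.Balaban1983to89.MatrixLog (mlog)
open T4QuatExpLog (ψ ψ_zero ψ_of_ne_zero)

variable {m : Type*} [Fintype m] [DecidableEq m] [Nonempty m] {ι : Type*} [Fintype ι]

/-! ## §1 The vector form of KEY and the operator-norm bound `‖φ(B_Z)X − X‖ ≤ ψ(ρ)‖X‖` -/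

omit [Nonempty m] [Fintype ι] in
/-- `‖A_Z M‖ ≤ ‖Z‖·‖M‖` in operator norm (`A_Z M = ½(ZM − MZ)`). [folklore] -/
theorem norm_adh_le (Z M : Matrix m m ℂ) : ‖adh Z M‖ ≤ ‖Z‖ * ‖M‖ := by
  rw [adh_apply, norm_smul]
  have h2 : ‖(2 : ℂ)⁻¹‖ = 2⁻¹ := by simp
  have h3 : ‖Z * M‖ ≤ ‖Z‖ * ‖M‖ := norm_mul_le _ _
  have h4 : ‖M * Z‖ ≤ ‖M‖ * ‖Z‖ := norm_mul_le _ _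
  have h5 : ‖Z * M - M * Z‖ ≤ ‖Z * M‖ + ‖M * Z‖ := norm_sub_le _ _
  rw [h2]
  nlinarith [norm_nonneg (Z * M - M * Z)]

omit [Nonempty m] [Fintype ι] in
/-- **Resolvent solutions are operator-small**: `P_{R,Z} v = A_Z X` ⇒ `(R − ‖Z‖²)·‖v‖ ≤ ‖Z‖·‖X‖`. [folklore] -/
theorem norm_sol_le {R : ℝ} {Z X v : Matrix m m ℂ} (hv : Pop R Z v = adh Z X) :
    (R - ‖Z‖ ^ 2) * ‖v‖ ≤ ‖Z‖ * ‖X‖ := by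
  have h1 : (R : ℂ) • v = adh Z X - adh Z (adh Z v) := by
    rw [← hv, Pop_apply]; abel
  have h2 : ‖(R : ℂ) • v‖ = |R| * ‖v‖ := by rw [norm_smul, Complex.norm_real, Real.norm_eq_abs]
  have h3 : ‖adh Z X - adh Z (adh Z v)‖ ≤ ‖Z‖ * ‖X‖ + ‖Z‖ * (‖Z‖ * ‖v‖) :=
    (norm_sub_le _ _).trans (add_le_add (norm_adh_le Z X) ((norm_adh_le Z _).trans
      (mul_le_mul_of_nonneg_left (norm_adh_le Z v) (norm_nonneg Z))))
  rw [← h1, h2] at h3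
  have h4 : R * ‖v‖ ≤ |R| * ‖v‖ := mul_le_mul_of_nonneg_right (le_abs_self R) (norm_nonneg v)
  nlinarith

section Frame

variable {U : Matrix m m ℂ}

omit [Nonempty m] [Fintype ι] in
/-- `A_Z` on the frame: `A_Z (U E_{ab} U*) = −iβ_{ab}·(U E_{ab} U*)`. [folklore] -/
theorem adh_Fu (hU : star U * U = 1) (θ : m → ℝ) {Z : Matrix m m ℂ}
    (hZU : Z = U * diagonal (fun a => -I * (θ a : ℂ)) * star U) (a b : m) :
    adh Z (Fu U a b) = (-I * (((θ a - θ b) / 2 : ℝ) : ℂ)) • Fu U a b := by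
  have hl : Z * Fu U a b = (-I * (θ a : ℂ)) • Fu U a b := by rw [hZU]; exact frame_mul_Fu hU _ a b
  have hr : Fu U a b * Z = (-I * (θ b : ℂ)) • Fu U a b := by rw [hZU]; exact Fu_mul_frame hU _ a b
  rw [adh_apply, hl, hr, ← sub_smul, smul_smul]
  congr 1
  push_cast
  ring

omit [Nonempty m] [Fintype ι] in
/-- `P_{R,Z}` on the frame: `P_{R,Z} (U E_{ab} U*) = (R − β_{ab}²)·(U E_{ab} U*)`. [folklore] -/
theorem Pop_Fu (hU : star U * U = 1) (θ : m → ℝ) {Z : Matrix m m ℂ}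
    (hZU : Z = U * diagonal (fun a => -I * (θ a : ℂ)) * star U) (R : ℝ) (a b : m) :
    Pop R Z (Fu U a b) = ((R - ((θ a - θ b) / 2) ^ 2 : ℝ) : ℂ) • Fu U a b := by
  rw [Pop_apply, adh_Fu hU θ hZU, map_smul, adh_Fu hU θ hZU, smul_smul, ← add_smul]
  congr 1
  push_cast
  have hI : I * I = -1 := Complex.I_mul_I
  linear_combination (((θ a : ℂ) - (θ b : ℂ)) / 2) ^ 2 * hI

omit [Nonempty m] [Fintype ι] in
/-- **The resolvent solutions in frame form** (pub-balaban KEY's `vₙ`, isolated): with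
`vₙ := U·((−iβ_{ab}∕(Rₙ − β_{ab}²))·X'_{ab})·U*` one has `P_{Rₙ,Z} vₙ = A_Z X` (`|β_{ab}| < π`). [folklore] -/
theorem Pop_frameSol (hU : star U * U = 1) (hU' : U * star U = 1) (θ : m → ℝ) (hβ : ∀ a b, |(θ a - θ b) / 2| < Real.pi)
    {Z : Matrix m m ℂ} (hZU : Z = U * diagonal (fun a => -I * (θ a : ℂ)) * star U) (X : Matrix m m ℂ) (n : ℕ) :
    Pop (Rn n) Z (U * Matrix.of (fun a b => (-I * (((θ a - θ b) / 2 : ℝ) : ℂ) / ((Rn n - ((θ a - θ b) / 2) ^ 2 : ℝ) : ℂ))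
      * (star U * X * U) a b) * star U) = adh Z X := by
  have hlev : ∀ a b, 0 < Rn n - ((θ a - θ b) / 2) ^ 2 := by
    intro a b
    have h1 : ((θ a - θ b) / 2) ^ 2 < Real.pi ^ 2 := by
      have h' := abs_lt.1 (hβ a b)
      nlinarith [abs_nonneg ((θ a - θ b) / 2), sq_abs ((θ a - θ b) / 2), Real.pi_pos]
    linarith [pi_sq_le_Rn n]
  conv_rhs => rw [(conj_unconj hU' X).symm]
  rw [linmap_frame (Pop (Rn n) Z) _ (Pop_Fu hU θ hZU (Rn n)), linmap_frame (adh Z) _ (adh_Fu hU θ hZU)]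
  congr 2
  ext a b
  simp only [Matrix.of_apply]
  have hne : (((Rn n - ((θ a - θ b) / 2) ^ 2 : ℝ)) : ℂ) ≠ 0 := Complex.ofReal_ne_zero.2 (hlev a b).ne'
  generalize (((Rn n - ((θ a - θ b) / 2) ^ 2 : ℝ)) : ℂ) = R at hne ⊢
  generalize ((((θ a - θ b) / 2 : ℝ)) : ℂ) = β
  field_simp

omit [DecidableEq m] [Nonempty m] [Fintype ι] in
/-- Entrywise-to-matrix `HasSum` through a fixed conjugation: if `Σₙ wₙ(a,b) = w(a,b)` for all `a, b`, then
`Σₙ U·(wₙ·X')·U* = U·(w·X')·U*`. [folklore] -/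
theorem hasSum_frameMul {w : ℕ → m → m → ℂ} {wl : m → m → ℂ} (hw : ∀ a b, HasSum (fun n => w n a b) (wl a b))
    (X' : Matrix m m ℂ) :
    HasSum (fun n => U * Matrix.of (fun a b => w n a b * X' a b) * star U)
      (U * Matrix.of (fun a b => wl a b * X' a b) * star U) := by
  have h1 : HasSum (fun n => (Matrix.of (fun a b => w n a b * X' a b) : Matrix m m ℂ))
      (Matrix.of (fun a b => wl a b * X' a b)) :=
    Pi.hasSum.2 fun a => Pi.hasSum.2 fun b => by
      simpa only [Matrix.of_apply] using (hw a b).mul_right (X' a b)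
  exact (h1.mul_left U).mul_right (star U)

omit [Nonempty m] [Fintype ι] in
/-- ★★ **THE VECTOR FORM OF KEY**: `Σₙ 2·A_Z vₙ = φ(B_Z)X − X` for the resolvent solutions `vₙ` of `Pop_frameSol`
(`φ(B_Z)X = U·((1 − ψβ_{ab})·X'_{ab})·U*`; entrywise `Σₙ 2(−iβ)(−iβ)∕(Rₙ − β²) = −Σₙ 2β²∕(Rₙ − β²) = −ψ(β)`, `hasSum_ψ'`). [folklore] -/
theorem hasSum_adh_frameSol (hU : star U * U = 1) (hU' : U * star U = 1) (θ : m → ℝ) (hβ : ∀ a b, |(θ a - θ b) / 2| < Real.pi)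
    {Z : Matrix m m ℂ} (hZU : Z = U * diagonal (fun a => -I * (θ a : ℂ)) * star U) (X : Matrix m m ℂ) :
    HasSum (fun n : ℕ => (2 : ℂ) • adh Z (U * Matrix.of (fun a b =>
        (-I * (((θ a - θ b) / 2 : ℝ) : ℂ) / ((Rn n - ((θ a - θ b) / 2) ^ 2 : ℝ) : ℂ)) * (star U * X * U) a b) * star U))
      (U * Matrix.of (fun a b => ((1 - ψ ((θ a - θ b) / 2) : ℝ) : ℂ) * (star U * X * U) a b) * star U - X) := by
  set X' : Matrix m m ℂ := star U * X * U with hX'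
  -- the summands in frame form
  have hsummand : ∀ n : ℕ, (2 : ℂ) • adh Z (U * Matrix.of (fun a b =>
        (-I * (((θ a - θ b) / 2 : ℝ) : ℂ) / ((Rn n - ((θ a - θ b) / 2) ^ 2 : ℝ) : ℂ)) * X' a b) * star U)
      = U * Matrix.of (fun a b => -(((2 * ((θ a - θ b) / 2) ^ 2 / (Rn n - ((θ a - θ b) / 2) ^ 2) : ℝ) : ℂ)) * X' a b)
        * star U := by
    intro n
    rw [linmap_frame (adh Z) _ (adh_Fu hU θ hZU), ← smul_mul_assoc, ← mul_smul_comm]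
    congr 2
    ext a b
    simp only [Matrix.smul_apply, Matrix.of_apply, smul_eq_mul]
    have hI : I * I = -1 := Complex.I_mul_I
    push_cast
    linear_combination (2 * (((θ a : ℂ) - (θ b : ℂ)) / 2) ^ 2 / ((Rn n : ℂ) - (((θ a : ℂ) - (θ b : ℂ)) / 2) ^ 2)
      * X' a b) * hI
  -- the limit in frame form
  have hlim : U * Matrix.of (fun a b => ((1 - ψ ((θ a - θ b) / 2) : ℝ) : ℂ) * X' a b) * star U - X
      = U * Matrix.of (fun a b => -(((ψ ((θ a - θ b) / 2) : ℝ) : ℂ)) * X' a b) * star U := by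
    conv_lhs => rw [(conj_unconj hU' X).symm]
    rw [← hX', ← Matrix.sub_mul, ← Matrix.mul_sub]
    congr 2
    ext a b
    simp only [Matrix.sub_apply, Matrix.of_apply]
    push_cast
    ring
  simp_rw [hsummand]
  rw [hlim]
  refine hasSum_frameMul (w := fun n a b => -(((2 * ((θ a - θ b) / 2) ^ 2 / (Rn n - ((θ a - θ b) / 2) ^ 2) : ℝ) : ℂ)))
    (wl := fun a b => -(((ψ ((θ a - θ b) / 2) : ℝ) : ℂ))) (fun a b => ?_) X'
  have h1 := hasSum_ψ' (hβ a b)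
  have h2 : ∀ n : ℕ, 2 * ((θ a - θ b) / 2) ^ 2 / (((n : ℝ) + 1) ^ 2 * Real.pi ^ 2 - ((θ a - θ b) / 2) ^ 2)
      = 2 * ((θ a - θ b) / 2) ^ 2 / (Rn n - ((θ a - θ b) / 2) ^ 2) := fun n => by rw [Rn]
  simp_rw [h2] at h1
  exact (Complex.hasSum_ofReal.2 h1).neg

omit [Nonempty m] [Fintype ι] in
/-- The scalar majorant: `Σₙ 2ρ²∕(Rₙ − ρ²) = ψ(ρ)` for `0 ≤ ρ < π` (`hasSum_ψ'` at `β = ρ`). [folklore] -/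
theorem hasSum_majorant {ρ : ℝ} (hρ0 : 0 ≤ ρ) (hρπ : ρ < Real.pi) :
    HasSum (fun n : ℕ => 2 * ρ ^ 2 / (Rn n - ρ ^ 2)) (ψ ρ) := by
  have h := hasSum_ψ' (β := ρ) (by rw [abs_of_nonneg hρ0]; exact hρπ)
  have h2 : ∀ n : ℕ, 2 * ρ ^ 2 / (((n : ℝ) + 1) ^ 2 * Real.pi ^ 2 - ρ ^ 2) = 2 * ρ ^ 2 / (Rn n - ρ ^ 2) := fun n => by rw [Rn]
  simp_rw [h2] at h
  exact h

omit [Nonempty m] [Fintype ι] in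
/-- ★★★ **THE ψ-DEFECT IS AN OPERATOR-NORM CONTRACTION BY `ψ(ρ)`.**  For skew-Hermitian `Z` in a frame `Z = U diag(−iθ) U*` whose half-angles
satisfy `|β_{ab}| ≤ ρ`, with `‖Z‖ ≤ ρ < π`:
  `‖U·((1 − ψβ_{ab})·X'_{ab})·U* − X‖ ≤ ψ(ρ)·‖X‖`     (operator norm, every `N`).
PROOF.  `φ(B_Z)X − X = Σₙ 2A_Z vₙ` (`hasSum_adh_frameSol`); `‖2A_Z vₙ‖ ≤ 2‖Z‖‖vₙ‖ ≤ 2‖Z‖²‖X‖∕(Rₙ − ‖Z‖²) ≤ 2ρ²‖X‖∕(Rₙ − ρ²)` (`norm_adh_le`,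
`norm_sol_le`, `Pop_frameSol`); sum = `ψ(ρ)‖X‖` (`hasSum_majorant`). [folklore] -/
theorem norm_phi_sub_self_le (hU : star U * U = 1) (hU' : U * star U = 1) (θ : m → ℝ) {ρ : ℝ}
    (hβρ : ∀ a b, |(θ a - θ b) / 2| ≤ ρ) (hρπ : ρ < Real.pi) {Z : Matrix m m ℂ}
    (hZU : Z = U * diagonal (fun a => -I * (θ a : ℂ)) * star U) (hZρ : ‖Z‖ ≤ ρ) (X : Matrix m m ℂ) :
    ‖U * Matrix.of (fun a b => ((1 - ψ ((θ a - θ b) / 2) : ℝ) : ℂ) * (star U * X * U) a b) * star U - X‖ ≤ ψ ρ * ‖X‖ := by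
  have hρ0 : 0 ≤ ρ := (norm_nonneg Z).trans hZρ
  have hβ : ∀ a b, |(θ a - θ b) / 2| < Real.pi := fun a b => (hβρ a b).trans_lt hρπ
  set v : ℕ → Matrix m m ℂ := fun n => U * Matrix.of (fun a b =>
      (-I * (((θ a - θ b) / 2 : ℝ) : ℂ) / ((Rn n - ((θ a - θ b) / 2) ^ 2 : ℝ) : ℂ)) * (star U * X * U) a b) * star U with hv
  have hsum : HasSum (fun n : ℕ => (2 : ℂ) • adh Z (v n))
      (U * Matrix.of (fun a b => ((1 - ψ ((θ a - θ b) / 2) : ℝ) : ℂ) * (star U * X * U) a b) * star U - X) :=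
    hasSum_adh_frameSol hU hU' θ hβ hZU X
  have hPop : ∀ n, Pop (Rn n) Z (v n) = adh Z X := fun n => Pop_frameSol hU hU' θ hβ hZU X n
  -- levels
  have hlev : ∀ n, 0 < Rn n - ρ ^ 2 := fun n => by
    have h1 : ρ ^ 2 < Real.pi ^ 2 := by nlinarith [Real.pi_pos]
    linarith [pi_sq_le_Rn n]
  have hZ2 : ‖Z‖ ^ 2 ≤ ρ ^ 2 := by nlinarith [norm_nonneg Z]
  -- termwise bound
  have hterm : ∀ n, ‖(2 : ℂ) • adh Z (v n)‖ ≤ 2 * ρ ^ 2 / (Rn n - ρ ^ 2) * ‖X‖ := by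
    intro n
    have h1 : ‖(2 : ℂ) • adh Z (v n)‖ = 2 * ‖adh Z (v n)‖ := by rw [norm_smul]; simp
    have h2 : ‖adh Z (v n)‖ ≤ ‖Z‖ * ‖v n‖ := norm_adh_le Z (v n)
    have h3 : (Rn n - ‖Z‖ ^ 2) * ‖v n‖ ≤ ‖Z‖ * ‖X‖ := norm_sol_le (hPop n)
    have h4 : (Rn n - ρ ^ 2) * ‖v n‖ ≤ ρ * ‖X‖ := by
      have := mul_le_mul_of_nonneg_right hZρ (norm_nonneg X)
      nlinarith [norm_nonneg (v n)]
    have h5 : ‖v n‖ ≤ ρ * ‖X‖ / (Rn n - ρ ^ 2) := by rw [le_div_iff₀ (hlev n)]; linarith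
    have h6 : ‖adh Z (v n)‖ ≤ ρ * (ρ * ‖X‖ / (Rn n - ρ ^ 2)) :=
      h2.trans (mul_le_mul hZρ h5 (norm_nonneg _) hρ0)
    rw [h1]
    have h7 : ρ * (ρ * ‖X‖ / (Rn n - ρ ^ 2)) = ρ ^ 2 / (Rn n - ρ ^ 2) * ‖X‖ := by
      field_simp
    rw [h7] at h6
    have h8 : 2 * ρ ^ 2 / (Rn n - ρ ^ 2) * ‖X‖ = 2 * (ρ ^ 2 / (Rn n - ρ ^ 2) * ‖X‖) := by ring
    rw [h8]
    linarith
  have hmaj : HasSum (fun n : ℕ => 2 * ρ ^ 2 / (Rn n - ρ ^ 2) * ‖X‖) (ψ ρ * ‖X‖) := (hasSum_majorant hρ0 hρπ).mul_right ‖X‖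
  rw [← hsum.tsum_eq, ← hmaj.tsum_eq]
  have hs1 : Summable fun n => ‖(2 : ℂ) • adh Z (v n)‖ :=
    Summable.of_nonneg_of_le (fun n => norm_nonneg _) hterm hmaj.summable
  exact (norm_tsum_le_tsum_norm hs1).trans (hs1.tsum_le_tsum hterm hmaj.summable)

end Frame

/-! ## §2 The symmetrised tangent image and the tangent map in operator norm -/

omit [Fintype ι] in
/-- ★★ **THE SYMMETRISED TANGENT IMAGE IN OPERATOR NORM.**  `Zᵢ` skew-Hermitian with `‖Zᵢ‖ ≤ ρᵢ ≤ 1`, weights `cᵢ ≥ 0`, `Σcᵢ ≤ 1`,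
`Y = ΣcᵢZᵢ`; for ANY solutions `dexp(Zᵢ)Hᵢ = exp(Zᵢ)X`, `dexp(Y)H_Y = exp(Y)X`:
  `‖H_Y − ΣcᵢHᵢ‖ ≤ (1 − Σcᵢ + ψ(Σcᵢρᵢ) + Σcᵢψρᵢ)·‖X‖`.
PROOF.  `Hᵢ = φ(B_{Zᵢ})X + ½ad_{Zᵢ}X`, `H_Y = φ(B_Y)X + ½ad_Y X` (g4 `solution_eq_phi_add_adh`), `ad_Y = Σcᵢad_{Zᵢ}` (`adh_sum_smul`), so
`H_Y − ΣcᵢHᵢ = (φ(B_Y)X − X) − Σcᵢ(φ(B_{Zᵢ})X − X) + (1 − Σcᵢ)X`; §1 bounds each defect (`‖Y‖ ≤ Σcᵢρᵢ`). [folklore] -/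
theorem norm_symmetrised_le {ι : Type*} [Fintype ι] {Z : ι → Matrix m m ℂ} (hZ : ∀ i, (Z i)ᴴ = -Z i) (ρ : ι → ℝ)
    (hZρ : ∀ i, ‖Z i‖ ≤ ρ i) (hρ1 : ∀ i, ρ i ≤ 1) (c : ι → ℝ) (hc0 : ∀ i, 0 ≤ c i) (hc1 : ∑ i, c i ≤ 1) (X : Matrix m m ℂ)
    (H : ι → Matrix m m ℂ) (HY : Matrix m m ℂ) (hH : ∀ i, dexp (Z i) (H i) = exp (Z i) * X)
    (hY : dexp (∑ i, (c i : ℂ) • Z i) HY = exp (∑ i, (c i : ℂ) • Z i) * X) :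
    ‖HY - ∑ i, (c i : ℂ) • H i‖ ≤ (1 - ∑ i, c i + ψ (∑ i, c i * ρ i) + ∑ i, c i * ψ (ρ i)) * ‖X‖ := by
  have hρ0 : ∀ i, 0 ≤ ρ i := fun i => (norm_nonneg _).trans (hZρ i)
  set Y : Matrix m m ℂ := ∑ i, (c i : ℂ) • Z i with hYdef
  have hYskew : Yᴴ = -Y := conjTranspose_sum_smul c hZ
  set ρY : ℝ := ∑ i, c i * ρ i with hρY
  have hYρ : ‖Y‖ ≤ ρY := by
    calc ‖Y‖ ≤ ∑ i, ‖(c i : ℂ) • Z i‖ := norm_sum_le _ _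
      _ ≤ ∑ i, c i * ρ i := Finset.sum_le_sum fun i _ => by
          rw [norm_smul, Complex.norm_real, Real.norm_of_nonneg (hc0 i)]
          exact mul_le_mul_of_nonneg_left (hZρ i) (hc0 i)
  have hρY1 : ρY ≤ 1 := by
    calc ρY = ∑ i, c i * ρ i := rfl
      _ ≤ ∑ i, c i := Finset.sum_le_sum fun i _ => by nlinarith [hc0 i, hρ1 i]
      _ ≤ 1 := hc1
  have hρY0 : 0 ≤ ρY := Finset.sum_nonneg fun i _ => mul_nonneg (hc0 i) (hρ0 i)
  have hπ : (1 : ℝ) < Real.pi := by linarith [Real.pi_gt_three]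
  -- frames
  obtain ⟨U₀, θ₀, hU₀, hU₀', hYU, hβ₀ρ, hβ₀⟩ := exists_frame_le hYskew hYρ hρY1
  have hfr := fun i => exists_frame_le (hZ i) (hZρ i) (hρ1 i)
  choose V θ hV hV' hZV hβρ hβπ using hfr
  -- the solutions in symmetric/antisymmetric form
  have hHi : ∀ i, H i = V i * Matrix.of (fun a b => ((1 - ψ ((θ i a - θ i b) / 2) : ℝ) : ℂ) * (star (V i) * X * V i) a b)
      * star (V i) + adh (Z i) X := fun i => solution_eq_phi_add_adh (hV i) (hV' i) (θ i) (hβπ i) (hZV i) X (H i) (hH i)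
  have hHY : HY = U₀ * Matrix.of (fun a b => ((1 - ψ ((θ₀ a - θ₀ b) / 2) : ℝ) : ℂ) * (star U₀ * X * U₀) a b) * star U₀
      + adh Y X := solution_eq_phi_add_adh hU₀ hU₀' θ₀ hβ₀ hYU X HY hY
  -- the `½ad` halves cancel
  have hadY : adh Y X = ∑ i, (c i : ℂ) • adh (Z i) X := by rw [hYdef]; exact adh_sum_smul c Z X
  set Φ₀ : Matrix m m ℂ := U₀ * Matrix.of (fun a b => ((1 - ψ ((θ₀ a - θ₀ b) / 2) : ℝ) : ℂ) * (star U₀ * X * U₀) a b) * star U₀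
  set Φ : ι → Matrix m m ℂ := fun i =>
    V i * Matrix.of (fun a b => ((1 - ψ ((θ i a - θ i b) / 2) : ℝ) : ℂ) * (star (V i) * X * V i) a b) * star (V i)
  have hdiff : HY - ∑ i, (c i : ℂ) • H i = (Φ₀ - X) - ∑ i, (c i : ℂ) • (Φ i - X) + ((1 - ∑ i, c i : ℝ) : ℂ) • X := by
    have e1 : ∑ i, (c i : ℂ) • H i = ∑ i, (c i : ℂ) • Φ i + ∑ i, (c i : ℂ) • adh (Z i) X := by
      rw [← Finset.sum_add_distrib]
      exact Finset.sum_congr rfl fun i _ => by rw [hHi i, smul_add]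
    have e2 : ∑ i, (c i : ℂ) • (Φ i - X) = ∑ i, (c i : ℂ) • Φ i - ((∑ i, c i : ℝ) : ℂ) • X := by
      rw [Complex.ofReal_sum, Finset.sum_smul, ← Finset.sum_sub_distrib]
      exact Finset.sum_congr rfl fun i _ => by rw [smul_sub]
    have e3 : ((1 - ∑ i, c i : ℝ) : ℂ) • X = X - ((∑ i, c i : ℝ) : ℂ) • X := by
      rw [Complex.ofReal_sub, Complex.ofReal_one, sub_smul, one_smul]
    rw [hHY, e1, e2, hadY, e3]
    abel
  -- bounds
  have b0 : ‖Φ₀ - X‖ ≤ ψ ρY * ‖X‖ := norm_phi_sub_self_le hU₀ hU₀' θ₀ hβ₀ρ (by linarith) hYU hYρ X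
  have bi : ∀ i, ‖Φ i - X‖ ≤ ψ (ρ i) * ‖X‖ := fun i =>
    norm_phi_sub_self_le (hV i) (hV' i) (θ i) (hβρ i) (by linarith [hρ1 i]) (hZV i) (hZρ i) X
  have b1 : ‖∑ i, (c i : ℂ) • (Φ i - X)‖ ≤ ∑ i, c i * ψ (ρ i) * ‖X‖ := by
    calc ‖∑ i, (c i : ℂ) • (Φ i - X)‖ ≤ ∑ i, ‖(c i : ℂ) • (Φ i - X)‖ := norm_sum_le _ _
      _ ≤ ∑ i, c i * ψ (ρ i) * ‖X‖ := Finset.sum_le_sum fun i _ => by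
          rw [norm_smul, Complex.norm_real, Real.norm_of_nonneg (hc0 i), mul_assoc]
          exact mul_le_mul_of_nonneg_left (bi i) (hc0 i)
  have hl0 : 0 ≤ 1 - ∑ i, c i := by linarith
  have b2 : ‖((1 - ∑ i, c i : ℝ) : ℂ) • X‖ = (1 - ∑ i, c i) * ‖X‖ := by
    rw [norm_smul, Complex.norm_real, Real.norm_of_nonneg hl0]
  rw [hdiff]
  calc ‖Φ₀ - X - ∑ i, (c i : ℂ) • (Φ i - X) + ((1 - ∑ i, c i : ℝ) : ℂ) • X‖
      ≤ ‖Φ₀ - X - ∑ i, (c i : ℂ) • (Φ i - X)‖ + ‖((1 - ∑ i, c i : ℝ) : ℂ) • X‖ := norm_add_le _ _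
    _ ≤ (‖Φ₀ - X‖ + ‖∑ i, (c i : ℂ) • (Φ i - X)‖) + ‖((1 - ∑ i, c i : ℝ) : ℂ) • X‖ := by
        gcongr; exact norm_sub_le _ _
    _ ≤ (ψ ρY * ‖X‖ + ∑ i, c i * ψ (ρ i) * ‖X‖) + (1 - ∑ i, c i) * ‖X‖ := by rw [b2]; gcongr
    _ = (1 - ∑ i, c i + ψ (∑ i, c i * ρ i) + ∑ i, c i * ψ (ρ i)) * ‖X‖ := by
        rw [hρY, ← Finset.sum_mul]; ring

/-- `‖dexp Y M‖ ≤ e^{‖Y‖}·‖M‖` (pv11's `ExpFDeriv.norm_fderiv_exp_le`). [folklore] -/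
theorem norm_dexp_le (Y M : Matrix m m ℂ) : ‖dexp Y M‖ ≤ Real.exp ‖Y‖ * ‖M‖ := by
  unfold dexp
  exact (ContinuousLinearMap.le_opNorm _ _).trans
    (mul_le_mul_of_nonneg_right (Literature.Analysis.SpecialFunctions.ExpFDeriv.norm_fderiv_exp_le ℂ Y) (norm_nonneg _))

/-- ★★★ **THE TANGENT MAP OF THE PRINTED FIBRE MAP IN OPERATOR NORM, EVERY `N`.**  For unitary `W`, unitaries `hᵢ` in the guard
`‖hᵢW* − 1‖ < 1∕2`, weights `cᵢ ≥ 0` with `Σcᵢ ≤ 1`, a skew-Hermitian `X`, and radii `‖log(hᵢW*)‖ ≤ ρᵢ ≤ 1`: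
  `‖D K_W(W X)‖ ≤ e^{Σcᵢρᵢ}·(1 − Σcᵢ + ψ(Σcᵢρᵢ) + Σcᵢψρᵢ)·‖X‖`.
PROOF.  `D K_W(WX)·W* = exp(Y)X̃ − dexp(Y)(ΣcᵢHᵢ) = dexp(Y)(H_Y − ΣcᵢHᵢ)` for the solutions `Hᵢ = D log(hᵢW*)(hᵢW*X̃)` and a `Y`-solution
`H_Y` (pub-balaban's bookkeeping, `dexp Y` onto); `‖dexp Y‖ ≤ e^{‖Y‖}`; `norm_symmetrised_le`; `‖X̃‖ = ‖X‖`, `‖·W*‖ = ‖·‖`. [folklore] -/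
theorem norm_emlD_tangent_le {h : ι → Matrix m m ℂ} (hh : ∀ i, h i ∈ unitaryGroup m ℂ) {W : Matrix m m ℂ}
    (hWu : W ∈ unitaryGroup m ℂ) (hg : ∀ i, ‖h i * star W - 1‖ < 1 / 2) {c : ι → ℝ} (hc0 : ∀ i, 0 ≤ c i)
    (hc1 : ∑ i, c i ≤ 1) (ρ : ι → ℝ) (hρ : ∀ i, ‖mlog (h i * star W)‖ ≤ ρ i) (hρ1 : ∀ i, ρ i ≤ 1)
    (X : Matrix m m ℂ) (hX : Xᴴ = -X) :
    ‖emlD h c W (W * X)‖ ≤ Real.exp (∑ i, c i * ρ i) * (1 - ∑ i, c i + ψ (∑ i, c i * ρ i) + ∑ i, c i * ψ (ρ i)) * ‖X‖ := by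
  have hW1 : star W * W = 1 := Matrix.mem_unitaryGroup_iff'.mp hWu
  have hW2 : W * star W = 1 := Matrix.mem_unitaryGroup_iff.mp hWu
  have hP1 : ∀ i, ‖h i * star W - 1‖ < 1 := fun i => lt_trans (hg i) (by norm_num)
  obtain ⟨hZskew, -, hYskew, hYn⟩ := guard_skew_norm hh hWu hg hc0 hc1
  have hX' : star X = -X := by rw [Matrix.star_eq_conjTranspose, hX]
  set Y : Matrix m m ℂ := ∑ i, (c i : ℂ) • mlog (h i * star W)
  set Xt : Matrix m m ℂ := W * X * star W with hXt
  set E : Matrix m m ℂ := emlD h c W (W * X)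
  set H : ι → Matrix m m ℂ := fun i => fderiv ℂ mlog (h i * star W) (h i * star W * Xt)
  have hHi : ∀ i, dexp (mlog (h i * star W)) (H i) = exp (mlog (h i * star W)) * Xt := fun i => by
    show dexp (mlog (h i * star W)) (fderiv ℂ mlog (h i * star W) (h i * star W * Xt)) = _
    rw [dexp_mlog_fderiv (hP1 i), MatrixLog.exp_mlog (hP1 i)]
  have hPX : ∀ i, h i * star (W * X) = -(h i * star W * Xt) := by
    intro i
    rw [star_mul, hX', neg_mul, mul_neg, hXt, show h i * star W * (W * X * star W)
      = h i * (star W * W) * (X * star W) by noncomm_ring, hW1, mul_one]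
  have hE : E * star W = exp Y * Xt - dexp Y (∑ i, (c i : ℂ) • H i) := by
    have h0 : E = exp Y * (W * X) + dexp Y (∑ i, (c i : ℂ) • fderiv ℂ mlog (h i * star W) (h i * star (W * X))) * W :=
      emlD_apply h c W (W * X)
    have h1 : (∑ i, (c i : ℂ) • fderiv ℂ mlog (h i * star W) (h i * star (W * X))) = -∑ i, (c i : ℂ) • H i := by
      rw [← Finset.sum_neg_distrib]
      refine Finset.sum_congr rfl fun i _ => ?_
      rw [hPX, map_neg, smul_neg]
    have h0' : E = exp Y * (W * X) - dexp Y (∑ i, (c i : ℂ) • H i) * W := by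
      rw [h0, h1, map_neg, neg_mul, ← sub_eq_add_neg]
    rw [h0', hXt, sub_mul, mul_assoc, mul_assoc (dexp Y _) W (star W), hW2, mul_one]
  obtain ⟨G', hG'⟩ := (dexp_lower_bound_and_surjective hYskew one_pos (by linarith [Real.pi_gt_three]) hYn).2 (E * star W)
  have hY : dexp Y (G' + ∑ i, (c i : ℂ) • H i) = exp Y * Xt := by
    rw [map_add, hG', hE]; abel
  have key := norm_symmetrised_le hZskew ρ hρ hρ1 c hc0 hc1 Xt H _ hHi hY
  rw [add_sub_cancel_right] at key
  -- norms
  have hρ0 : ∀ i, 0 ≤ ρ i := fun i => (norm_nonneg _).trans (hρ i)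
  have hYρ : ‖Y‖ ≤ ∑ i, c i * ρ i := by
    calc ‖Y‖ ≤ ∑ i, ‖(c i : ℂ) • mlog (h i * star W)‖ := norm_sum_le _ _
      _ ≤ ∑ i, c i * ρ i := Finset.sum_le_sum fun i _ => by
          rw [norm_smul, Complex.norm_real, Real.norm_of_nonneg (hc0 i)]
          exact mul_le_mul_of_nonneg_left (hρ i) (hc0 i)
  have hXX : ‖Xt‖ = ‖X‖ := by
    rw [hXt, CStarRing.norm_mul_mem_unitary (W * X) (Unitary.star_mem hWu), CStarRing.norm_mem_unitary_mul X hWu]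
  have hEE : ‖E‖ = ‖E * star W‖ := (CStarRing.norm_mul_mem_unitary E (Unitary.star_mem hWu)).symm
  calc ‖E‖ = ‖dexp Y G'‖ := by rw [hEE, ← hG']
    _ ≤ Real.exp ‖Y‖ * ‖G'‖ := norm_dexp_le Y G'
    _ ≤ Real.exp (∑ i, c i * ρ i) * ((1 - ∑ i, c i + ψ (∑ i, c i * ρ i) + ∑ i, c i * ψ (ρ i)) * ‖Xt‖) :=
        mul_le_mul (Real.exp_le_exp.2 hYρ) key (norm_nonneg _) (Real.exp_pos _).le
    _ = Real.exp (∑ i, c i * ρ i) * (1 - ∑ i, c i + ψ (∑ i, c i * ρ i) + ∑ i, c i * ψ (ρ i)) * ‖X‖ := by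
        rw [hXX]; ring

/-- ★★ **THE W-UNIFORM CONSTANT.**  On the guard `‖log(hᵢW*)‖ < log 2`, so with `s = Σcᵢ ≤ 1`:
`‖D K_W(W X)‖ ≤ e^{s·log 2}·(1 − s + ψ(s·log 2) + s·ψ(log 2))·‖X‖ ≤ 2·(1 − s + 2ψ(log 2))·‖X‖` — uniformly in `W` and in `N`. [folklore] -/
theorem norm_emlD_tangent_le_log_two {h : ι → Matrix m m ℂ} (hh : ∀ i, h i ∈ unitaryGroup m ℂ) {W : Matrix m m ℂ}
    (hWu : W ∈ unitaryGroup m ℂ) (hg : ∀ i, ‖h i * star W - 1‖ < 1 / 2) {c : ι → ℝ} (hc0 : ∀ i, 0 ≤ c i)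
    (hc1 : ∑ i, c i ≤ 1) (X : Matrix m m ℂ) (hX : Xᴴ = -X) :
    ‖emlD h c W (W * X)‖
      ≤ Real.exp ((∑ i, c i) * Real.log 2) * (1 - ∑ i, c i + ψ ((∑ i, c i) * Real.log 2) + (∑ i, c i) * ψ (Real.log 2)) * ‖X‖ := by
  have hl2 : Real.log 2 ≤ 1 := by have := Real.log_two_lt_d9; linarith
  have h := norm_emlD_tangent_le hh hWu hg hc0 hc1 (fun _ => Real.log 2) (fun i => (norm_mlog_lt_log_two (hg i)).le)
    (fun _ => hl2) X hX
  simpa only [← Finset.sum_mul] using h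

end Summit.QuantumFields.YangMills.BalabanUVNodes.N08HaarCompatibilityGuardDefectOperatorNorm
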